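import Literature.NumberTheory.Transcendental.NesterenkoMultiplicityResidual
import Literature.NumberTheory.Transcendental.NesterenkoMultiplicityHeightsPrincipal
import Literature.NumberTheory.Transcendental.NesterenkoHyperChowDegreeK
import HarnessLib

/-!
# Nesterenko's multiplicity estimate (LNM 1752 Ch. 10 Thm 1.1): what remains for the book's heights over `ℂ(z)` — proofs only

`Literature/NumberTheory/Transcendental/NesterenkoMultiplicityResidualBook.lean` — proofs only (no
definitions, no named facts). With the concrete data of the printed proof now in the tree — the valued field
`𝒦 = CzBar` and `ι` (`NesterenkoMultiplicityValuedField`), the heights `h(I) = heightI I r`,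
`h(P) = heightP P` over `K = ℂ(z)` (`NesterenkoMultiplicityHeights`) with `h ≥ 0`, `h(Q) ≤ deg_z Q`,
Ch. 3 Prop. 4.7 2) (`NesterenkoMultiplicityHeightsGauss`), Macaulay's theorem (`macaulay_field`) and Ch. 3
Cor. 4.9 (`NesterenkoK.cor_4_9_field`) — Theorem 1.1 of Ch. 10 (`NesterenkoPhilippon2001_ch10_thm_1_1`)
follows from exactly five printed statements plus the constant `γ₁ ≥ 1`: Ch. 10 Lemma 3.1 [Nes3],
Ch. 10 Lemma 3.5 [Nes6], Ch. 3 Prop. 4.8 clause 3) (`|I(ω̄)| ≤ ‖P‖_ω̄`, non-archimedean; clauses 1)–2) are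
theorems: `NesterenkoK.ideg_span_singleton`, `heightI_span_singleton_le`), Prop. 4.11, Prop. 4.13 over
`K = ℂ(z)` at `𝒦` (`thm_1_1_of_bookHeights`).

## References

* [NesterenkoPhilippon2001] Yu. V. Nesterenko, P. Philippon (eds.), *Introduction to Algebraic
  Independence Theory*, LNM 1752, Springer 2001, Ch. 10 Thm. 1.1 (p. 150), Lemma 3.1, Lemma 3.5
  (pp. 153–156); Ch. 3 §4 Prop. 4.8, 4.11, 4.13 (pp. 40–41).
-/

noncomputable section

open MvPolynomial
open scoped Polynomial

namespace Literature.NumberTheory.Transcendental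

namespace NesterenkoMultiplicity

open Literature.NumberTheory.Transcendental.NesterenkoK

attribute [local instance] MvPolynomial.gradedAlgebra

/-- **Theorem 1.1 of LNM 1752 Ch. 10 from the book's heights and five printed statements**: with the heights
`h(I) = heightI I r`, `h(P) = heightP P` of `ℂ(z)[x₀, …, x_m]` (`NesterenkoMultiplicityHeights.lean`, for which
`h ≥ 0`, `h(Q) ≤ deg_z Q` and Ch. 3 Prop. 4.7 2) are theorems), Theorem 1.1 follows from: a constant
`γ₁ ≥ 1` with Ch. 10 Lemma 3.1 [Nes3], Ch. 10 Lemma 3.5 [Nes6], and Ch. 3 Prop. 4.8 clause 3), Prop. 4.11,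
Prop. 4.13 over `K = ℂ(z)` at `𝒦 = CzBar` (non-archimedean forms). These five are exactly the inputs of the
printed proof that are not (yet) theorems of the tree. [cite: NesterenkoPhilippon2001, Ch. 10 Thm. 1.1 (p. 150), §§2–4 (pp. 152–162)] -/
theorem thm_1_1_of_bookHeights
    (H : ∀ m : ℕ, 1 ≤ m → ∃ γ₁ : ℝ, 1 ≤ γ₁ ∧
        -- lemma_3_1
        (∀ (r : ℕ) (𝔭 : Ideal (Kx m)), 1 ≤ r → r ≤ m → 𝔭.IsPrime →
        𝔭.IsHomogeneous (homogeneousSubmodule (Fin (m + 1)) (RatFunc ℂ)) → IsUnmixedOfRank 𝔭 r →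
        ∀ μ ν : ℕ, 1 ≤ ν →
          (charFn 𝔭 μ ν : ℝ) ≤ γ₁ * (((μ : ℝ) + 1) * (ν : ℝ) ^ (r - 1) * ideg 𝔭 r + (ν : ℝ) ^ r * heightI 𝔭 r)) ∧
        -- lemma_3_5
        (∀ (r : ℕ) (I J : Ideal (Kx m)) (Q : Czx m) (d : ℕ), 2 ≤ r → r ≤ m →
        I.IsHomogeneous (homogeneousSubmodule (Fin (m + 1)) (RatFunc ℂ)) → IsUnmixedOfRank I r →
        J.IsHomogeneous (homogeneousSubmodule (Fin (m + 1)) (RatFunc ℂ)) → IsUnmixedOfRank J (r - 1) →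
        Q.IsHomogeneous d → (∀ 𝔮 ∈ I.associatedPrimes, toK Q ∉ 𝔮) → I ⊔ Ideal.span {toK Q} ≤ J →
          ideg J (r - 1) ≤ ideg I r * d ∧ heightI J (r - 1) ≤ heightI I r * d + ideg I r * zDeg Q) ∧
        -- prop_4_8, clause 3) only (`|I(ω̄)| ≤ ‖P‖_ω̄`, non-archimedean); clauses 1)–2) are theorems
        (∀ (P : Kx m) (d : ℕ), 1 ≤ m → P ≠ 0 → P.IsHomogeneous d → 1 ≤ d →
        IsUnmixedOfRank (Ideal.span {P}) m → ∀ ω : Fin (m + 1) → CzBar, ω ≠ 0 →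
          iabs (Ideal.span {P}) m ω ≤ normAt ω P) ∧
        -- prop_4_11
        (∀ (r : ℕ) (𝔭 : Ideal (Kx m)) (Q : Kx m) (d : ℕ), 1 ≤ r → r ≤ m → 𝔭.IsPrime →
        𝔭.IsHomogeneous (homogeneousSubmodule (Fin (m + 1)) (RatFunc ℂ)) → IsUnmixedOfRank 𝔭 r →
        Q.IsHomogeneous d → 1 ≤ d → Q ∉ 𝔭 →
          (2 ≤ r → ∃ J : Ideal (Kx m),
            J.IsHomogeneous (homogeneousSubmodule (Fin (m + 1)) (RatFunc ℂ)) ∧ IsUnmixedOfRank J (r - 1) ∧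
            (projZeros J : Set (Fin (m + 1) → CzBar)) = projZeros (𝔭 ⊔ Ideal.span {Q}) ∧
            ideg J (r - 1) ≤ ideg 𝔭 r * d ∧
            heightI J (r - 1) ≤ heightI 𝔭 r * d + heightP Q * ideg 𝔭 r ∧
            ∀ ω : Fin (m + 1) → CzBar, ω ≠ 0 →
              iabs J (r - 1) ω ≤ (if rho ω 𝔭 < normAt ω Q then normAt ω Q else iabs 𝔭 r ω) *
                Real.exp (heightP Q * ideg 𝔭 r + heightI 𝔭 r * d)) ∧
          (r = 1 → ∀ ω : Fin (m + 1) → CzBar, ω ≠ 0 →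
            (1 : ℝ) ≤ (if rho ω 𝔭 < normAt ω Q then normAt ω Q else iabs 𝔭 r ω) *
              Real.exp (heightP Q * ideg 𝔭 r + heightI 𝔭 r * d))) ∧
        -- prop_4_13
        (∀ (r : ℕ) (I : Ideal (Kx m)), 1 ≤ r → r ≤ m →
        I.IsHomogeneous (homogeneousSubmodule (Fin (m + 1)) (RatFunc ℂ)) → IsUnmixedOfRank I r →
        ∀ ω : Fin (m + 1) → CzBar, ω ≠ 0 → ∃ β ∈ (projZeros I : Set (Fin (m + 1) → CzBar)),
          projDist ω β ^ ideg I r ≤ (iabs I r ω * Real.exp (heightI I r)) ^ (1 / (r : ℝ)))) :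
    NesterenkoPhilippon2001_ch10_thm_1_1 := by
  intro m hm A f _ _ hsol hDP
  obtain ⟨γ₁, h4, h31, h35, h48, h411, h413⟩ := H m hm
  have h48' : ∀ (P : Kx m) (d : ℕ), 1 ≤ m → P ≠ 0 → P.IsHomogeneous d → 1 ≤ d →
      IsUnmixedOfRank (Ideal.span {P}) m → ∀ ω : Fin (m + 1) → CzBar, ω ≠ 0 →
        ideg (Ideal.span {P}) m = d ∧ heightI (Ideal.span {P}) m ≤ heightP P ∧
          iabs (Ideal.span {P}) m ω ≤ normAt ω P :=
    fun P d hm1 hP0 hP hd hunm ω hω =>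
      ⟨ideg_span_singleton hm1 hP0 hP (by omega), heightI_span_singleton_le hP0 hP hd,
        h48 P d hm1 hP0 hP hd hunm ω hω⟩
  have T : CzToolkit m CzBar heightI heightP γ₁ :=
    ⟨heightI_nonneg, heightP_nonneg, heightP_toK_le, h4, h31, h35, prop_4_7_height_heightI m, h48',
      cor_4_9_field m, h411, h413, macaulay_field (RatFunc ℂ) m⟩
  exact thm_1_1_of_toolkit_at norm_iota T hm A f hsol hDP

end NesterenkoMultiplicity

end Literature.NumberTheory.Transcendental

end
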